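import Summits.HodgeConjecture.HodgeConjecture.Theorems.Ring2AbelianAllAndreFibreClassDivisorialOfHodgeType
import HarnessLib

/-!
# Ring 2 · sub-cell AbelianAll (ALL ABELIAN VARIETIES), André axis, part XV-c — THE LEFSCHETZ COLUMN AND THE LIFT
# COLUMN COINCIDE ON HODGE-INVARIANT PENCILS: `HC_CM ∧ (L) ⟹ (β′_f)` for every CM-pointed compact pencil whose
# rational invariant classes are Hodge classes on the fibres (converse of part VIII's `(β′) ⟹ (L)` on that class)

HONEST FRAMING (page 1, verbatim): **research route, not a corollary; conditional on HC_CM plus one named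
minimal statement.** Cell line: research route conditional on HC_CM; not a corollary; Q11.4-sentence-2
already refuted in dim ≥ 3. Nothing in this file proves a case of the Hodge conjecture for an abelian variety.
`HC_CM` = `Theses.RankFourFaces.CMAbelianHodge` (a BINDER wherever it occurs, never cited, never an axiom), item
`Theses.RankFourFaces.CMToAbelian` (stmt-16267) OPEN and not closed here. Seat `pub-hodge-ring2-ab-andre-2`,
gen 7 (with parts XV-a, XV-b).

## What is proved (theorems only; no definition, no named fact, no sorry)

* **`algebraicInvariantClassesAt_of_cmFibreAlgebraicLift_of_HC_CM`** — `HC_CM`, the lift node (L)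
  `CMFibreAlgebraicLift` of part I, a compact pencil `f : 𝒳 ⟶ S` of abelian `d`-folds with a CM fibre
  `t₀ ∈ cmLocus f d`, and "HODGE INVARIANTS in degree `2p`": every rational `W ∈ H²ᵖ(𝒳)` restricts to a class of
  type `(p,p)` on EVERY fibre ⟹ (N_p)(t₀) (`AlgebraicInvariantClassesAt hf t₀ p`). Proof: for rational `W`,
  `j_{t₀}^* W` is a rational `(p,p)`-class of the CM fibre, algebraic by `HC_CM`
  (`Ring2Transport.mem_algebraicClasses_of_cmChart`, the ONLY use of `HC_CM`); (L) lifts it to an algebraic `η`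
  with `j_{t₀}^* η = j_{t₀}^* W`; the classes admitting such a partner form a `ℂ`-subspace and rational classes
  span `H²ᵖ(𝒳(ℂ); ℂ)`.
* **`fibreClassLefschetzOn_of_cmFibreAlgebraicLift_of_HC_CM`** — with Hodge invariants in the degrees `2p ≤ d`:
  **`HC_CM ∧ (L) ⟹ (β′_f)`** (part XIV-g `fibreClassLefschetzOn_of_algebraicInvariants_half`: product cycles).
* `fibreClassLefschetzOn_of_algebraicFixedPart_of_HC_CM` — the same from (L∀) `AlgebraicFixedPart`.
* Converse direction for the record: `exists_lift_at_of_fibreClassLefschetzOn` — (β′_f) ⟹ the (L)-conclusion on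
  that pencil (part VIII's engine; no `HC_CM`, no Hodge hypothesis).

## Reading (RING2-MAP §AbelianAll (ab-andre-2, gen 7))

Parts V/VIII proved `(β′) ⟹ (L)` in the kernel with no fact; the converse is false in general (the lift node only
speaks about classes ALREADY algebraic on the CM fibre, (β′_f) about all invariant classes). This part shows the
gap is exactly "invariant classes that are not Hodge": on CM-pointed pencils with Hodge invariants — in print every
pencil with big monodromy (`I_{2p} = ℚθᵖ`), and the Weil habitat (W_E)₃ (`I₆ = ℚθ³ ⊕ W_K`) — `HC_CM ⊢ (L) ⟹
(β′_f)`. Together with part XV-b (`HC_CM ⊢ (β′_f) ⟺ ⋀(N_p)(t₀)`) and part XV-a (balanced / relative cycles never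
witness (β′_f)): on the W₆ habitat the three formulations "fibre-class Lefschetz operator is algebraic", "the CM
fibre's Hodge invariants lift to algebraic classes of `𝒳`", "(N₁)(N₂)(N₃) at one fibre" are ONE statement modulo
`HC_CM`; the Lefschetz column offers no cheaper currency than the lift. Edge label: (L)|_{HI} ⟹ (β′_f):
K[HC_CM; Hodge-invariants binder].

NOT CLAIMED: Hodge invariance of any concrete pencil; (L); any case of the Hodge conjecture.

References: Abdulali1994FamiliesAV (Conj. 5.3, Thm. 5.5 p. 1130, Lemma 6.2 p. 1131); Andre1996Motifs (§5.1 p. 25,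
§6.3 Lemme 6.3.1, Remarque 2 pp. 31–33); Milne1999 (§7 p. 72); Voisin2025 (Prop. 2.11); DeligneHodgeII1971 (4.1.1).
-/

noncomputable section

set_option linter.dupNamespace false

namespace Summit.HodgeConjecture.HodgeConjecture.Ring2.AbelianAll

open CategoryTheory AlgebraicGeometry MonoidalCategory CartesianMonoidalCategory
open Literature.AlgebraicGeometry Literature.AlgebraicGeometry.Motives
open Literature.AlgebraicGeometry.HodgeTheory
open Literature.AlgebraicTopology.SingularHomology (singularCohomology)
open Literature.AlgebraicGeometry.Milne1999 (IsOfCMType)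
open Literature.AlgebraicGeometry.Deligne1982 (cmLocus)
open Summit.HodgeConjecture.HodgeConjecture.Theses

variable {𝒳 S : SchemeOver ℂ}

/-- The classes of `H²ᵖ(𝒳)` agreeing on the fibre `𝒳_{t₀}` with some global algebraic class form a `ℂ`-subspace;
if it contains every rational class it is everything (rational classes span `H²ᵖ(𝒳(ℂ); ℂ)`,
`span_isRationalClass_eq_top_of_isSmoothProjective_holds`). [cite: VoisinHodgeI2002, §11.3.3 Lemma 11.41]
[cite: Voisin2025, Lemma 2.9] -/
theorem algebraicInvariantClassesAt_of_rational {d : ℕ} {f : 𝒳 ⟶ S} (hf : IsCompactAbelianPencil f d)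
    (t₀ : ComplexPoints S) (p : ℕ)
    (h : ∀ W : complexBetti 𝒳 (2 * p), IsRationalClass W → ∃ D ∈ algebraicClasses 𝒳 p,
      complexBetti.map (fiberι f t₀) (2 * p) D = complexBetti.map (fiberι f t₀) (2 * p) W) :
    AlgebraicInvariantClassesAt hf t₀ p := by
  have h𝒳 := hf.isSmoothProjective_total
  let M : Submodule ℂ (complexBetti 𝒳 (2 * p)) :=
    { carrier := {W | ∃ D ∈ algebraicClasses 𝒳 p,
        complexBetti.map (fiberι f t₀) (2 * p) D = complexBetti.map (fiberι f t₀) (2 * p) W}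
      zero_mem' := ⟨0, Submodule.zero_mem _, rfl⟩
      add_mem' := by
        rintro W₁ W₂ ⟨D₁, hD₁, h₁⟩ ⟨D₂, hD₂, h₂⟩
        exact ⟨D₁ + D₂, Submodule.add_mem _ hD₁ hD₂, by rw [map_add, map_add, h₁, h₂]⟩
      smul_mem' := by
        rintro c W ⟨D, hD, h⟩
        exact ⟨c • D, Submodule.smul_mem _ c hD, by rw [map_smul, map_smul, h]⟩ }
  have hM : M = ⊤ := by
    rw [eq_top_iff, ← span_isRationalClass_eq_top_of_isSmoothProjective_holds (d + 1) 𝒳 h𝒳 (2 * p)]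
    exact Submodule.span_le.2 fun W hW ↦ h W hW
  intro W
  have hW : W ∈ M := hM ▸ Submodule.mem_top
  exact hW

/-- **`HC_CM ∧ (L) ⟹ (N_p)(t₀)` at a CM fibre of a pencil with Hodge invariants in degree `2p`.** For rational
`W`, `j_{t₀}^* W` is a rational `(p,p)`-class of the CM fibre `𝒳_{t₀}` — algebraic under `HC_CM`
(`Ring2Transport.mem_algebraicClasses_of_cmChart`, the ONLY use of `HC_CM`) — and `W` is fibrewise Hodge by
hypothesis, so the lift node (L) `CMFibreAlgebraicLift` provides an algebraic `η` with `j_{t₀}^* η = j_{t₀}^* W`;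
conclude by the previous lemma. research route, not a corollary; conditional on HC_CM plus one named minimal
statement. [cite: Andre1996Motifs, §5.1 (p. 25) and §6.3 Lemme 6.3.1 (p. 31)] [cite: Milne1999, §7 p. 72]
[cite: Abdulali1994FamiliesAV, Theorem 5.5 (p. 1130)] -/
theorem algebraicInvariantClassesAt_of_cmFibreAlgebraicLift_of_HC_CM (hCM : RankFourFaces.CMAbelianHodge)
    (hL : CMFibreAlgebraicLift) {d : ℕ} {f : 𝒳 ⟶ S} (hf : IsCompactAbelianPencil f d) {t₀ : ComplexPoints S}
    (ht₀ : t₀ ∈ cmLocus f d) (p : ℕ)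
    (hHodge : ∀ (s : ComplexPoints S) (W : complexBetti 𝒳 (2 * p)), IsRationalClass W →
      IsOfHodgeType d (fiberOver f s) (2 * p) p p (complexBetti.map (fiberι f s) (2 * p) W)) :
    AlgebraicInvariantClassesAt hf t₀ p := by
  obtain ⟨A₀, ⟨e₀⟩, hdim, hcm⟩ := id ht₀
  refine algebraicInvariantClassesAt_of_rational hf t₀ p fun W hW ↦ ?_
  exact hL f hf p W (fun s ↦ ⟨hW.pullback _, hHodge s W hW⟩) t₀ ht₀
    (Ring2Transport.mem_algebraicClasses_of_cmChart hCM A₀ e₀ hdim hcm (hW.pullback _) (hHodge t₀ W hW))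

/-- **`HC_CM ∧ (L) ⟹ (β′_f)` on every CM-pointed compact pencil with Hodge invariants in the degrees `2p ≤ d`**
(the previous theorem in each such degree, then part XIV-g's product cycles). The converse `(β′) ⟹ (L)` is part
VIII (no hypothesis), so on this class of pencils the Lefschetz-type node and the lift node COINCIDE modulo `HC_CM`.
research route, not a corollary; conditional on HC_CM plus one named minimal statement.
[cite: Abdulali1994FamiliesAV, Conjecture 5.3 and Theorem 5.5 (p. 1130)] [cite: Andre1996Motifs, §6.3 Remarque 2 (p. 33)] -/
theorem fibreClassLefschetzOn_of_cmFibreAlgebraicLift_of_HC_CM (hCM : RankFourFaces.CMAbelianHodge)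
    (hL : CMFibreAlgebraicLift) {d : ℕ} {f : 𝒳 ⟶ S} (hf : IsCompactAbelianPencil f d) {t₀ : ComplexPoints S}
    (ht₀ : t₀ ∈ cmLocus f d)
    (hHodge : ∀ p, 2 * p ≤ d → ∀ (s : ComplexPoints S) (W : complexBetti 𝒳 (2 * p)), IsRationalClass W →
      IsOfHodgeType d (fiberOver f s) (2 * p) p p (complexBetti.map (fiberι f s) (2 * p) W)) :
    FibreClassLefschetzOn hf :=
  fibreClassLefschetzOn_of_algebraicInvariants_half hf t₀ fun p hp ↦
    algebraicInvariantClassesAt_of_cmFibreAlgebraicLift_of_HC_CM hCM hL hf ht₀ p (hHodge p hp)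

/-- The same from the stronger lift node (L∀) `AlgebraicFixedPart` ((L∀) ⟹ (L), part I).
research route, not a corollary; conditional on HC_CM plus one named minimal statement.
[cite: Abdulali1994FamiliesAV, Theorem 5.5 (p. 1130)] -/
theorem fibreClassLefschetzOn_of_algebraicFixedPart_of_HC_CM (hCM : RankFourFaces.CMAbelianHodge)
    (hL : AlgebraicFixedPart) {d : ℕ} {f : 𝒳 ⟶ S} (hf : IsCompactAbelianPencil f d) {t₀ : ComplexPoints S}
    (ht₀ : t₀ ∈ cmLocus f d)
    (hHodge : ∀ p, 2 * p ≤ d → ∀ (s : ComplexPoints S) (W : complexBetti 𝒳 (2 * p)), IsRationalClass W →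
      IsOfHodgeType d (fiberOver f s) (2 * p) p p (complexBetti.map (fiberι f s) (2 * p) W)) :
    FibreClassLefschetzOn hf :=
  fibreClassLefschetzOn_of_cmFibreAlgebraicLift_of_HC_CM hCM (cmFibreAlgebraicLift_of_algebraicFixedPart hL) hf ht₀
    hHodge

/-- **Converse on one pencil, for the record**: (β′_f) gives the conclusion of (L) (indeed of (L∀)) on that pencil
— every global class algebraic on ONE fibre agrees on all fibres with a global algebraic class (part VIII's engine,
Abdulali's Theorem 5.5; no `HC_CM`, no Hodge hypothesis). [cite: Abdulali1994FamiliesAV, Theorem 5.5 (p. 1130)] -/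
theorem exists_lift_at_of_fibreClassLefschetzOn {d : ℕ} {f : 𝒳 ⟶ S} (hf : IsCompactAbelianPencil f d)
    (hF : FibreClassLefschetzOn hf) {p : ℕ} (W : complexBetti 𝒳 (2 * p)) (s₀ : ComplexPoints S)
    (h₀ : complexBetti.map (fiberι f s₀) (2 * p) W ∈ algebraicClasses (fiberOver f s₀) p) :
    ∃ η ∈ algebraicClasses 𝒳 p, ∀ s : ComplexPoints S,
      complexBetti.map (fiberι f s) (2 * p) η = complexBetti.map (fiberι f s) (2 * p) W :=
  exists_algebraic_lift_of_fibreClassLefschetzOn hf hF W h₀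

end Summit.HodgeConjecture.HodgeConjecture.Ring2.AbelianAll

end
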